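import Summits.CriticalPhenomena.PercolationContinuityZ3.Theorems.PercNearOneGluingNoHeavyLowerTailSahiGridPatternCoCountProductNCrossed
import Summits.CriticalPhenomena.PercolationContinuityZ3.Theorems.PercNearOneGluingNoHeavyLowerTailSahiGridPatternLiteralTwoGood
import Summits.CriticalPhenomena.PercolationContinuityZ3.Theorems.PercNearOneGluingNoHeavyLowerTailSahiGridPatternCrossedCanonical

/-!
# `NoHeavyLowerTail` (crux stmt-CriticalPhenomena-4575), Sahi programme P1: **THE SECTION EXPANSION OF A BLOCK PRODUCT and `GOOD × GOOD ⇒ GOOD` FOR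
# `(x∨y) × V` AT ALL SEPARATED TEST PAIRS WITH `P ⊆ {x ≥ 1}`** (every `k`; goodness of `V` at six section rectangles, Harris, one monotonicity)

Support file (Sahi cell, seat `prim-sahi-p1`, generation 45; `--supports stmt-CriticalPhenomena-4575`).  Pure proofs, no definitions, no `sorry`, standard axioms.
Vocabulary of `…SahiGridPattern{,CellForm,LiteralTwoGood,CoCountProductNProduct,CoCountProductNOrTwo,CoCountProductNCrossed,CrossedCanonical}`
(`Pd`, `glue`, `ind`, `sStarD`, `thetaVal`, `lamU`, `TotDist`, `thirdPt`).

THE MATHEMATICS (seat memo FROM-prim-sahi-p1-gen45, §1–§2).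
(1) `sStarD_blockAnd_sections` (every `n, k`, all finsets): for `A = S × V ⊆ [3]^{n+k}` and ANY `P, Q`,
  `sStarD A P Q = Σ_{ξ δ̸ η} [ 2·2^k 1_S(ξ) n(P^ξ∩Q^ξ) − 1_S(ξ) N(V; P^η∩Q^η) − 1_S(η) N(P^ξ; Q^η∩V) − 1_S(η) N(Q^ξ; P^η∩V) + 1_S(ξ̄η) μ_V(P^ξ, Q^η) ]`
  (`n(W) = #(W∩V)`, `N(X;Y) = #{(q,r) ∈ X×Y : q δ̸ r}`, `μ_V(X,Y) = #{(q,r) ∈ X×Y : q δ̸ r, q̄r ∈ V}`; sections `P^ξ = {q : glue ξ q ∈ P}`) — the exact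
  "polarised goodness" bookkeeping behind every block-product computation of this programme (the goodness slack of `V` at `(X,Y)` is the diagonal case
  `Φ_V(X,Y) = 2·2^k n(X∩Y) − N(V;X∩Y) − N(X;Y∩V) − N(Y;X∩V) + μ_V(X,Y)`).
(2) THE SEPARATED FAMILY WITH `P ⊆ {x ≥ 1}`: `S = x∨y`, `P^{(i,j)} = A_i` with `A_0 = ∅ ⊆ A_1 ⊆ A_2`, `Q^{(i,j)} = B_j` with `B_0 ⊆ B_1 ⊆ B_2` (the test sets depend on
  different outer coordinates; the crossed family of generations 42–45 is `A_1 = A_2`, `B_1 = B_2`).  A formal LP over the section monomials (seat code `famLP.py`)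
  finds the certificate
  `sStarD = Σ_{i=1,2} [4Φ(A_i,B_0) + 3Φ(A_i,B_1) + 3Φ(A_i,B_2)] + Σ_{i=1,2; j=1,2} [h_V(A_i,B_j) + h_V(B_j,A_i)] + 2[N(A_2;B_0∩V) − N(A_1;B_0∩V)] + 4N(A_1;B_0∩V)`,
  all brackets `≥ 0` for up-sets (goodness of `V` at six rectangles, coefficientwise Harris, `A_1 ⊆ A_2`).  **THEOREM `sStarD_blockAnd_orTwo_sepX_nonneg`** (every `k`):
  for up-sets with `V` good at the six section rectangles, `0 ≤ sStarD ((x∨y)×V) P Q`.  The same LP is INFEASIBLE when both corner sections `A_0, B_0` are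
  non-empty, for `P` a cylinder `[3]²×A₀` with `Q` general, and for `P ⊆ {x≥1}` with `Q` general (memo §2: black-box goodness + Harris + monotonicity + third-point
  Kleitman do not prove `T×` there).  HONEST LABEL: `PatternPos d` (`d ≥ 4`), Conjecture A and `T×` in general remain OPEN; nothing here asserts them. [this work]
-/

namespace Summit.CriticalPhenomena.PercolationContinuityZ3.Theorems.SahiGridPattern

open Finset SahiGrid3
open scoped BigOperators

/-! ### The section expansion -/

/-- **The section expansion of the pattern functional of a block product (every `n, k`; all finsets).**  For `A = S × V ⊆ [3]^{n+k}` and arbitrary test sets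
`P, Q ⊆ [3]^{n+k}`, `sStarD A P Q` is the sum over totally distinct outer pairs `(ξ,η)` (third point `ζ = ξ̄η`) of
`2·2^k·1_S(ξ)·#(P^ξ∩Q^ξ∩V) − 1_S(ξ)·N(V; P^η∩Q^η) − 1_S(η)·N(P^ξ; Q^η∩V) − 1_S(η)·N(Q^ξ; P^η∩V) + 1_S(ζ)·#{(q,r) ∈ P^ξ×Q^η : q δ̸ r, q̄r ∈ V}`
(all counts as indicator sums). [this work] -/
theorem sStarD_blockAnd_sections {n k : ℕ} {S : Finset (Pd n)} {V : Finset (Pd k)} {A : Finset (Pd (n + k))}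
    (hA : ∀ ξ z, glue ξ z ∈ A ↔ (ξ ∈ S ∧ z ∈ V)) (P Q : Finset (Pd (n + k))) :
    sStarD A P Q = ∑ ξ : Pd n, ∑ η : Pd n, (if TotDist ξ η = true then (1:ℤ) else 0) *
      ( 2 * (2:ℤ) ^ k * ind S ξ * (∑ q : Pd k, ind P (glue ξ q) * ind Q (glue ξ q) * ind V q)
        - ind S ξ * (∑ q : Pd k, ∑ r : Pd k, ind P (glue η r) * ind Q (glue η r) * (if TotDist q r = true then (1:ℤ) else 0) * ind V q)
        - ind S η * (∑ q : Pd k, ∑ r : Pd k, ind P (glue ξ q) * ind Q (glue η r) * (if TotDist q r = true then (1:ℤ) else 0) * ind V r)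
        - ind S η * (∑ q : Pd k, ∑ r : Pd k, ind Q (glue ξ q) * ind P (glue η r) * (if TotDist q r = true then (1:ℤ) else 0) * ind V r)
        + ind S (thirdPt ξ η) *
            (∑ q : Pd k, ∑ r : Pd k, ind P (glue ξ q) * ind Q (glue η r) * (if TotDist q r = true then (1:ℤ) else 0) * ind V (thirdPt q r)) ) := by
  rw [sStarD_eq_glue_pairSum]
  refine Finset.sum_congr rfl fun ξ _ => Finset.sum_congr rfl fun η _ => ?_
  have hpt : ∀ (q r : Pd k),
      (if TotDist ξ η = true then (1:ℤ) else 0) * (if TotDist q r = true then (1:ℤ) else 0) *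
        ( 2 * ind A (glue ξ q) * ind P (glue ξ q) * ind Q (glue ξ q)
          - ind A (glue ξ q) * ind P (glue η r) * ind Q (glue η r)
          - ind P (glue ξ q) * ind A (glue η r) * ind Q (glue η r)
          - ind Q (glue ξ q) * ind A (glue η r) * ind P (glue η r)
          + ind P (glue ξ q) * ind Q (glue η r) * ind A (glue (thirdPt ξ η) (thirdPt q r)) )
      = (if TotDist ξ η = true then (1:ℤ) else 0) * ((2 * ind S ξ) * (ind P (glue ξ q) * ind Q (glue ξ q) * ind V q * (if TotDist q r = true then (1:ℤ) else 0)))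
        - (if TotDist ξ η = true then (1:ℤ) else 0) * (ind S ξ * (ind P (glue η r) * ind Q (glue η r) * (if TotDist q r = true then (1:ℤ) else 0) * ind V q))
        - (if TotDist ξ η = true then (1:ℤ) else 0) * (ind S η * (ind P (glue ξ q) * ind Q (glue η r) * (if TotDist q r = true then (1:ℤ) else 0) * ind V r))
        - (if TotDist ξ η = true then (1:ℤ) else 0) * (ind S η * (ind Q (glue ξ q) * ind P (glue η r) * (if TotDist q r = true then (1:ℤ) else 0) * ind V r))
        + (if TotDist ξ η = true then (1:ℤ) else 0) * (ind S (thirdPt ξ η) *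
            (ind P (glue ξ q) * ind Q (glue η r) * (if TotDist q r = true then (1:ℤ) else 0) * ind V (thirdPt q r))) := by
    intro q r
    rw [ind_glue_product hA, ind_glue_product hA, ind_glue_product hA]
    ring
  rw [Finset.sum_congr rfl fun q _ => Finset.sum_congr rfl fun r _ => hpt q r]
  simp only [Finset.sum_add_distrib, Finset.sum_sub_distrib, ← Finset.mul_sum]
  have hT1 : (∑ q : Pd k, ind P (glue ξ q) * ind Q (glue ξ q) * ind V q * ∑ r : Pd k, (if TotDist q r = true then (1:ℤ) else 0))
      = 2 ^ k * ∑ q : Pd k, ind P (glue ξ q) * ind Q (glue ξ q) * ind V q := by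
    rw [Finset.mul_sum]
    refine Finset.sum_congr rfl fun q _ => ?_
    rw [sum_ite_totDist_eq_pow_left q]
    ring
  rw [hT1]
  ring

/-! ### Small conversion and sign lemmas for inner counts -/

/-- Swapping the two points of a pair count (`δ̸` is symmetric). [this work] -/
theorem pairCount_swap {d : ℕ} (X Y U : Finset (Pd d)) :
    (∑ q : Pd d, ∑ r : Pd d, ind X q * ind Y r * (if TotDist q r = true then (1:ℤ) else 0) * ind U r)
      = ∑ q : Pd d, ∑ r : Pd d, ind Y q * ind X r * (if TotDist q r = true then (1:ℤ) else 0) * ind U q := by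
  rw [Finset.sum_comm]
  refine Finset.sum_congr rfl fun q _ => Finset.sum_congr rfl fun r _ => ?_
  rw [ite_totDist_comm r q]
  ring

/-- The diagonal-rectangle pair count `N(V; X∩Y)` in the two index orders. [this work] -/
theorem diagCount_swap {d : ℕ} (X Y U : Finset (Pd d)) :
    (∑ q : Pd d, ∑ r : Pd d, ind X r * ind Y r * (if TotDist q r = true then (1:ℤ) else 0) * ind U q)
      = ∑ q : Pd d, ∑ r : Pd d, ind X q * ind Y q * (if TotDist q r = true then (1:ℤ) else 0) * ind U r := by
  rw [Finset.sum_comm]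
  refine Finset.sum_congr rfl fun q _ => Finset.sum_congr rfl fun r _ => ?_
  rw [ite_totDist_comm r q]

/-- `λ_V(X∩Y)` in counts: `Σ_{X∩Y} λ_V = 2·2^d·#(X∩Y∩V) − N(V; X∩Y)`. [this work] -/
theorem sum_inter_lamU_counts {d : ℕ} (U X Y : Finset (Pd d)) :
    (∑ q ∈ X ∩ Y, lamU U q) = 2 * (2:ℤ) ^ d * (∑ q : Pd d, ind X q * ind Y q * ind U q)
      - ∑ q : Pd d, ∑ r : Pd d, ind X q * ind Y q * (if TotDist q r = true then (1:ℤ) else 0) * ind U r := by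
  rw [sum_mem_eq_sum_ind_mul (X ∩ Y), Finset.mul_sum, ← Finset.sum_sub_distrib]
  refine Finset.sum_congr rfl fun q _ => ?_
  rw [ind_inter_eq_mul]
  unfold lamU
  rw [nuCount_eq_sum_ind, mul_sub, Finset.mul_sum]
  congr 1
  · ring
  · refine Finset.sum_congr rfl fun r _ => ?_
    rw [ite_totDist_comm r q]
    ring

/-- Goodness of `U` at the rectangle `(X,Y)` in counts: `α + α′ − μ ≤ 2·2^d n − N(V;X∩Y)`. [this work] -/
theorem good_rect_counts {d : ℕ} {U X Y : Finset (Pd d)}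
    (h : (∑ q ∈ X, ∑ r ∈ Y, thetaVal U q r) ≤ ∑ q ∈ X ∩ Y, lamU U q) :
    (∑ q : Pd d, ∑ r : Pd d, ind X q * ind Y r * (if TotDist q r = true then (1:ℤ) else 0) * ind U q)
      + (∑ q : Pd d, ∑ r : Pd d, ind X q * ind Y r * (if TotDist q r = true then (1:ℤ) else 0) * ind U r)
      - (∑ q : Pd d, ∑ r : Pd d, ind X q * ind Y r * (if TotDist q r = true then (1:ℤ) else 0) * ind U (thirdPt q r))
      ≤ 2 * (2:ℤ) ^ d * (∑ q : Pd d, ind X q * ind Y q * ind U q)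
        - ∑ q : Pd d, ∑ r : Pd d, ind X q * ind Y q * (if TotDist q r = true then (1:ℤ) else 0) * ind U r := by
  rw [theta_rect_eq_counts, sum_inter_lamU_counts] at h
  exact h

/-- Coefficientwise Harris for the diagonal rectangle: `N(V; X∩Y) ≤ 2^d·#(X∩Y∩V)` for up-sets. [this work] -/
theorem diagCount_le_harris {d : ℕ} {U X Y : Finset (Pd d)} (hU : IsUpperSet (U : Set (Pd d))) (hX : IsUpperSet (X : Set (Pd d)))
    (hY : IsUpperSet (Y : Set (Pd d))) :
    (∑ q : Pd d, ∑ r : Pd d, ind X q * ind Y q * (if TotDist q r = true then (1:ℤ) else 0) * ind U r)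
      ≤ 2 ^ d * ∑ q : Pd d, ind X q * ind Y q * ind U q := by
  have h := sum_ind_totDist_le d (X ∩ Y) U (isUpperSet_inter_coe hX hY) hU
  have e1 : (∑ p : Pd d, ∑ q : Pd d, ind (X ∩ Y) p * ind U q * (if TotDist p q = true then (1:ℤ) else 0))
      = ∑ q : Pd d, ∑ r : Pd d, ind X q * ind Y q * (if TotDist q r = true then (1:ℤ) else 0) * ind U r := by
    refine Finset.sum_congr rfl fun p _ => Finset.sum_congr rfl fun q _ => ?_
    rw [ind_inter_eq_mul]; ring
  have e2 : (2:ℤ) ^ d * (∑ p : Pd d, ind (X ∩ Y) p * ind U p) = 2 ^ d * ∑ q : Pd d, ind X q * ind Y q * ind U q := by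
    congr 1
    refine Finset.sum_congr rfl fun p _ => ?_
    rw [ind_inter_eq_mul]
  rw [e1, e2] at h
  exact h

/-- Monotonicity of a pair count in the first set. [this work] -/
theorem pairCount_mono_left {d : ℕ} {X X' : Finset (Pd d)} (hXX : X ⊆ X') (Y : Finset (Pd d)) (f : Pd d → Pd d → ℤ)
    (hf : ∀ q r, 0 ≤ f q r) :
    (∑ q : Pd d, ∑ r : Pd d, ind X q * ind Y r * f q r) ≤ ∑ q : Pd d, ∑ r : Pd d, ind X' q * ind Y r * f q r := by
  refine Finset.sum_le_sum fun q _ => Finset.sum_le_sum fun r _ => ?_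
  refine mul_le_mul_of_nonneg_right (mul_le_mul_of_nonneg_right ?_ (ind_nonneg' Y r)) (hf q r)
  unfold ind
  by_cases h : q ∈ X
  · rw [if_pos h, if_pos (hXX h)]
  · rw [if_neg h]; split_ifs <;> norm_num

/-! ### The separated family with `P ⊆ {x ≥ 1}` -/

section SepX

variable {k : ℕ} {S : Finset (Pd (1 + 1))} {V : Finset (Pd k)} {A : Finset (Pd ((1 + 1) + k))}

/-- Section values of `P` (`P^{(i,·)} = ∅, A₁, A₂`) and `Q` (`Q^{(·,j)} = B_j`) on the nine outer cells. [this work] -/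
theorem ind_sepX_vals {A1 A2 B0 B1 B2 : Finset (Pd k)} {P Q : Finset (Pd ((1 + 1) + k))} (hA12 : A1 ⊆ A2) (hB01 : B0 ⊆ B1) (hB12 : B1 ⊆ B2)
    (hP : ∀ ξ η q, glue (glue ξ η) q ∈ P ↔ ((1 ≤ ξ 0 ∧ q ∈ A1) ∨ (ξ 0 = 2 ∧ q ∈ A2)))
    (hQ : ∀ ξ η q, glue (glue ξ η) q ∈ Q ↔ (q ∈ B0 ∨ (1 ≤ η 0 ∧ q ∈ B1) ∨ (η 0 = 2 ∧ q ∈ B2))) :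
    (∀ (η : Pd 1) (q : Pd k), ind P (glue (glue (fun _ => (0:Fin 3)) η) q) = 0) ∧
    (∀ (η : Pd 1) (q : Pd k), ind P (glue (glue (fun _ => (1:Fin 3)) η) q) = ind A1 q) ∧
    (∀ (η : Pd 1) (q : Pd k), ind P (glue (glue (fun _ => (2:Fin 3)) η) q) = ind A2 q) ∧
    (∀ (ξ : Pd 1) (q : Pd k), ind Q (glue (glue ξ (fun _ => (0:Fin 3))) q) = ind B0 q) ∧
    (∀ (ξ : Pd 1) (q : Pd k), ind Q (glue (glue ξ (fun _ => (1:Fin 3))) q) = ind B1 q) ∧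
    (∀ (ξ : Pd 1) (q : Pd k), ind Q (glue (glue ξ (fun _ => (2:Fin 3))) q) = ind B2 q) := by
  have f11 : (1:Fin 3) ≤ 1 := le_rfl
  have f12 : (1:Fin 3) ≤ 2 := by decide
  have f10 : ¬ (1:Fin 3) ≤ 0 := by decide
  have f02 : ¬ (0:Fin 3) = 2 := by decide
  have f12' : ¬ (1:Fin 3) = 2 := by decide
  refine ⟨?_, ?_, ?_, ?_, ?_, ?_⟩
  · intro η q; unfold ind; simp only [hP, f10, f02, false_and, or_self, if_false]
  · intro η q; unfold ind; simp only [hP, f11, f12', true_and, false_and, or_false]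
  · intro η q; unfold ind
    simp only [hP, f12, true_and]
    by_cases h1 : q ∈ A1
    · rw [if_pos (Or.inl h1), if_pos (hA12 h1)]
    · by_cases h2 : q ∈ A2
      · rw [if_pos (Or.inr h2), if_pos h2]
      · rw [if_neg, if_neg h2]; rintro (h | h) <;> contradiction
  · intro ξ q; unfold ind
    simp only [hQ, f10, f02, false_and, or_false]
  · intro ξ q; unfold ind
    simp only [hQ, f11, f12', true_and, false_and, or_false]
    by_cases h0 : q ∈ B0
    · rw [if_pos (Or.inl h0), if_pos (hB01 h0)]
    · by_cases h1 : q ∈ B1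
      · rw [if_pos (Or.inr h1), if_pos h1]
      · rw [if_neg, if_neg h1]; rintro (h | h) <;> contradiction
  · intro ξ q; unfold ind
    simp only [hQ, f12, true_and]
    by_cases h0 : q ∈ B0
    · rw [if_pos (Or.inl h0), if_pos (hB12 (hB01 h0))]
    · by_cases h1 : q ∈ B1
      · rw [if_pos (Or.inr (Or.inl h1)), if_pos (hB12 h1)]
      · by_cases h2 : q ∈ B2
        · rw [if_pos (Or.inr (Or.inr h2)), if_pos h2]
        · rw [if_neg, if_neg h2]; rintro (h | h | h) <;> contradiction

/-- **THEOREM (`good × good ⇒ good` for `(x∨y) × V` at every separated test pair with `P ⊆ {x ≥ 1}`; every `k`).**  `S = x∨y` (`hS`), `A = S × V` (`hA`);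
inner up-sets `A₁ ⊆ A₂`, `B₀ ⊆ B₁ ⊆ B₂` and `V`; `P^{(i,j)} = (∅, A₁, A₂)_i` (`hP`), `Q^{(i,j)} = B_j` (`hQ`).  If `V` is good at the six section rectangles
`(A_i, B_j)` (`hG10 … hG22`, bilinear form), then `0 ≤ sStarD A P Q`.  Certificate (formal LP, seat code `famLP.py`):
`Σ_i [4Φ(A_i,B₀) + 3Φ(A_i,B₁) + 3Φ(A_i,B₂)] + Σ_{i;j≥1} [h_V(A_i,B_j) + h_V(B_j,A_i)] + 2[N(A₂;B₀∩V) − N(A₁;B₀∩V)] + 4N(A₁;B₀∩V)`. [this work] -/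
theorem sStarD_blockAnd_orTwo_sepX_nonneg (hS : ∀ ξ η : Pd 1, glue ξ η ∈ S ↔ (1 ≤ ξ 0 ∨ 1 ≤ η 0))
    (hV : IsUpperSet (V : Set (Pd k))) (hA : ∀ σ z, glue σ z ∈ A ↔ (σ ∈ S ∧ z ∈ V))
    {A1 A2 B0 B1 B2 : Finset (Pd k)} (hA1 : IsUpperSet (A1 : Set (Pd k))) (hA2 : IsUpperSet (A2 : Set (Pd k)))
    (hB0 : IsUpperSet (B0 : Set (Pd k))) (hB1 : IsUpperSet (B1 : Set (Pd k))) (hB2 : IsUpperSet (B2 : Set (Pd k)))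
    (hA12 : A1 ⊆ A2) (hB01 : B0 ⊆ B1) (hB12 : B1 ⊆ B2)
    (hG10 : (∑ q ∈ A1, ∑ r ∈ B0, thetaVal V q r) ≤ ∑ q ∈ A1 ∩ B0, lamU V q)
    (hG11 : (∑ q ∈ A1, ∑ r ∈ B1, thetaVal V q r) ≤ ∑ q ∈ A1 ∩ B1, lamU V q)
    (hG12 : (∑ q ∈ A1, ∑ r ∈ B2, thetaVal V q r) ≤ ∑ q ∈ A1 ∩ B2, lamU V q)
    (hG20 : (∑ q ∈ A2, ∑ r ∈ B0, thetaVal V q r) ≤ ∑ q ∈ A2 ∩ B0, lamU V q)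
    (hG21 : (∑ q ∈ A2, ∑ r ∈ B1, thetaVal V q r) ≤ ∑ q ∈ A2 ∩ B1, lamU V q)
    (hG22 : (∑ q ∈ A2, ∑ r ∈ B2, thetaVal V q r) ≤ ∑ q ∈ A2 ∩ B2, lamU V q)
    {P Q : Finset (Pd ((1 + 1) + k))}
    (hP : ∀ ξ η q, glue (glue ξ η) q ∈ P ↔ ((1 ≤ ξ 0 ∧ q ∈ A1) ∨ (ξ 0 = 2 ∧ q ∈ A2)))
    (hQ : ∀ ξ η q, glue (glue ξ η) q ∈ Q ↔ (q ∈ B0 ∨ (1 ≤ η 0 ∧ q ∈ B1) ∨ (η 0 = 2 ∧ q ∈ B2))) :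
    0 ≤ sStarD A P Q := by
  obtain ⟨h00, h11, h22, h01, h02, h10, h12, h20, h21, t01, t02, t10, t12, t20, t21⟩ := pd1_facts
  obtain ⟨u00, u01, u02, u10, u11, u12, u20, u21, u22⟩ := ind_orTwo_vals hS
  obtain ⟨p0, p1, p2, q0, q1, q2⟩ := ind_sepX_vals hA12 hB01 hB12 hP hQ
  -- goodness in counts
  have g10 := good_rect_counts hG10
  have g11 := good_rect_counts hG11
  have g12 := good_rect_counts hG12
  have g20 := good_rect_counts hG20
  have g21 := good_rect_counts hG21
  have g22 := good_rect_counts hG22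
  -- coefficientwise Harris (three forms) at the six rectangles
  have a10 := pairCount_le_harris hV hA1 hB0
  have a11 := pairCount_le_harris hV hA1 hB1
  have a12 := pairCount_le_harris hV hA1 hB2
  have a20 := pairCount_le_harris hV hA2 hB0
  have a21 := pairCount_le_harris hV hA2 hB1
  have a22 := pairCount_le_harris hV hA2 hB2
  have b10 := pairCount_le_harris' hV hA1 hB0
  have b11 := pairCount_le_harris' hV hA1 hB1
  have b12 := pairCount_le_harris' hV hA1 hB2
  have b20 := pairCount_le_harris' hV hA2 hB0
  have b21 := pairCount_le_harris' hV hA2 hB1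
  have b22 := pairCount_le_harris' hV hA2 hB2
  have c10 := diagCount_le_harris hV hA1 hB0
  have c11 := diagCount_le_harris hV hA1 hB1
  have c12 := diagCount_le_harris hV hA1 hB2
  have c20 := diagCount_le_harris hV hA2 hB0
  have c21 := diagCount_le_harris hV hA2 hB1
  have c22 := diagCount_le_harris hV hA2 hB2
  -- monotonicity `A₁ ⊆ A₂` for `N(A_i; B₀∩V)` and nonnegativity of the leftover counts
  have m0 := pairCount_mono_left hA12 B0 (fun q r => (if TotDist q r = true then (1:ℤ) else 0) * ind V r)
    (fun q r => mul_nonneg (by split_ifs <;> norm_num) (ind_nonneg' V r))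
  have n10 : 0 ≤ ∑ q : Pd k, ∑ r : Pd k, ind A1 q * ind B0 r * (if TotDist q r = true then (1:ℤ) else 0) * ind V r :=
    Finset.sum_nonneg fun q _ => Finset.sum_nonneg fun r _ =>
      mul_nonneg (mul_nonneg (mul_nonneg (ind_nonneg' A1 q) (ind_nonneg' B0 r)) (by split_ifs <;> norm_num)) (ind_nonneg' V r)
  have n20 : 0 ≤ ∑ q : Pd k, ∑ r : Pd k, ind A2 q * ind B0 r * (if TotDist q r = true then (1:ℤ) else 0) * ind V r :=
    Finset.sum_nonneg fun q _ => Finset.sum_nonneg fun r _ =>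
      mul_nonneg (mul_nonneg (mul_nonneg (ind_nonneg' A2 q) (ind_nonneg' B0 r)) (by split_ifs <;> norm_num)) (ind_nonneg' V r)
  have m0' : (∑ q : Pd k, ∑ r : Pd k, ind A1 q * ind B0 r * (if TotDist q r = true then (1:ℤ) else 0) * ind V r)
      ≤ ∑ q : Pd k, ∑ r : Pd k, ind A2 q * ind B0 r * (if TotDist q r = true then (1:ℤ) else 0) * ind V r := by
    have e : ∀ X : Finset (Pd k), (∑ q : Pd k, ∑ r : Pd k, ind X q * ind B0 r * ((if TotDist q r = true then (1:ℤ) else 0) * ind V r))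
        = ∑ q : Pd k, ∑ r : Pd k, ind X q * ind B0 r * (if TotDist q r = true then (1:ℤ) else 0) * ind V r :=
      fun X => Finset.sum_congr rfl fun q _ => Finset.sum_congr rfl fun r _ => by ring
    rw [← e A1, ← e A2]; exact m0
  -- expand
  rw [sStarD_blockAnd_sections hA P Q]
  simp only [sum_glue (n := 1) (k := 1), sum_pd1, ite_totDist_glue, thirdPt_glue,
    h00, h11, h22, h01, h02, h10, h12, h20, h21, t01, t02, t10, t12, t20, t21,
    u00, u01, u02, u10, u11, u12, u20, u21, u22, p0, p1, p2, q0, q1, q2,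
    Bool.false_eq_true, if_false, if_true, zero_mul, mul_zero, mul_one, one_mul, zero_add, add_zero, zero_sub, sub_zero,
    Finset.sum_const_zero]
  -- the swapped counts `N(Q^ξ; P^η ∩ V)` and `N(V; ·)` in standard orientation
  simp only [pairCount_swap B0, pairCount_swap B1, pairCount_swap B2, diagCount_swap]
  linarith [g10, g11, g12, g20, g21, g22, a10, a11, a12, a20, a21, a22, b10, b11, b12, b20, b21, b22,
    c10, c11, c12, c20, c21, c22, m0', n10, n20]

end SepX

end Summit.CriticalPhenomena.PercolationContinuityZ3.Theorems.SahiGridPattern
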